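import Mathlib.RingTheory.Derivation.Basic
import Mathlib.Algebra.Polynomial.Derivation
import Mathlib.Algebra.Polynomial.Derivative
import Mathlib.RingTheory.Algebraic.Basic
import Mathlib.Tactic.LinearCombination
import Mathlib.Tactic.Ring
import HarnessLib

/-!
# Barrier (Schanuel) `NesterenkoModularScope`: transporting a derivation along an embedding — proofs only

`Literature/Barriers/Schanuel/NesterenkoModularScopeDerivationTransport.lean` — proofs-only
groundwork (no definitions, nothing asserted) for LNM 1752 Ch. 10 Proposition 5.1 (named fact
`NesterenkoPhilippon2001_ch10_prop_5_1`). In the printed proof (p. 166) the derivation `D` of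
the coordinate ring of the `D`-stable curve `V(𝔮)` is compared with `d/dx` along a branch:
"If we differentiate the equation `A(x, y(x)) ≡ 0` with respect to `x` … taking into account
that the triple `(x, y(x), z(x))` is a zero of … `DA` … Eliminating `∂A/∂x₁` … we find that the
functions `y(x), z(x)` satisfy the first differential equation in (76)". The algebraic content
is the following elimination, proved here for an arbitrary injective `K`-algebra map
`ι : A → B` between domains carrying `K`-derivations `D` (on `A`) and `E` (on `B`):

* `derivation_transport_of_eval₂_eq_zero` — if `x ∈ A` is transcendental over `K` and `f ∈ A`
  is a root of a non-zero `m(x, T) ∈ K[x][T]`, then `ι(Df)·E(ιx) = ι(Dx)·E(ιf)`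
  ("`D = (Dx)·d/dx` on algebraic functions of `x`", read in `B` through `ι`);
* `derivation_transport_add`, `_mul`, `_algebraMap` — the elements satisfying this identity
  form a `K`-subalgebra.

## References

* [NesterenkoPhilippon2001] LNM 1752, Ch. 10 §5, proof of Prop. 5.1 (p. 166, (83)) and of
  Lemma 5.3 (p. 163).
-/

noncomputable section

open Polynomial

namespace Literature.Barriers.Schanuel

variable {K A B : Type*} [Field K] [CommRing A] [Algebra K A] [CommRing B] [Algebra K B]

/-- The image of `m(x, f)` under `ι` is `m(ιx, ιf)`. [folklore] -/
theorem algHom_eval₂_aeval (ι : A →ₐ[K] B) (x f : A) (m : Polynomial (Polynomial K)) :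
    ι (Polynomial.eval₂ (Polynomial.aeval x : Polynomial K →ₐ[K] A).toRingHom f m) =
      Polynomial.eval₂ (Polynomial.aeval (ι x) : Polynomial K →ₐ[K] B).toRingHom (ι f) m := by
  rw [← AlgHom.coe_toRingHom, Polynomial.hom_eval₂]
  congr 1
  ext c
  · simp
  · simp

/-- **Differentiating `m(x, f)`**: for `K`-derivations `D` of `A` and `E` of `B` and a `K`-algebra
map `ι : A → B` there is `P ∈ A` (the coefficient-wise `x`-derivative of `m` at `(x, f)`) with
`D(m(x,f)) = Dx·P + Df·m_T(x,f)` and `E(m(ιx, ιf)) = E(ιx)·ιP + E(ιf)·ι(m_T(x,f))`.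
[cite: NesterenkoPhilippon2001, Ch. 10 §5 (83) (p. 166)] -/
theorem exists_derivation_eval₂ (D : Derivation K A A) (E : Derivation K B B) (ι : A →ₐ[K] B)
    (x f : A) (m : Polynomial (Polynomial K)) :
    ∃ P : A,
      D (Polynomial.eval₂ (Polynomial.aeval x : Polynomial K →ₐ[K] A).toRingHom f m) =
        D x * P + D f *
          Polynomial.eval₂ (Polynomial.aeval x : Polynomial K →ₐ[K] A).toRingHom f (derivative m) ∧
      E (Polynomial.eval₂ (Polynomial.aeval (ι x) : Polynomial K →ₐ[K] B).toRingHom (ι f) m) =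
        E (ι x) * ι P + E (ι f) *
          ι (Polynomial.eval₂ (Polynomial.aeval x : Polynomial K →ₐ[K] A).toRingHom f
            (derivative m)) := by
  induction m using Polynomial.induction_on' with
  | add p q hp hq =>
    obtain ⟨P, hP1, hP2⟩ := hp
    obtain ⟨Q, hQ1, hQ2⟩ := hq
    refine ⟨P + Q, ?_, ?_⟩
    · rw [Polynomial.eval₂_add, map_add, hP1, hQ1, derivative_add, Polynomial.eval₂_add]
      ring
    · rw [Polynomial.eval₂_add, map_add, hP2, hQ2, derivative_add, Polynomial.eval₂_add, map_add,
        map_add]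
      ring
  | monomial n c =>
    refine ⟨Polynomial.aeval x (derivative c) * f ^ n, ?_, ?_⟩
    · rw [derivative_monomial, Polynomial.eval₂_monomial, Polynomial.eval₂_monomial]
      simp only [AlgHom.toRingHom_eq_coe, RingHom.coe_coe]
      rw [Derivation.leibniz, Derivation.leibniz_pow, Derivation.map_aeval, map_mul,
        map_natCast]
      simp only [smul_eq_mul, nsmul_eq_mul]
      ring
    · rw [derivative_monomial, Polynomial.eval₂_monomial, Polynomial.eval₂_monomial]
      simp only [AlgHom.toRingHom_eq_coe, RingHom.coe_coe]
      rw [Derivation.leibniz, Derivation.leibniz_pow, Derivation.map_aeval]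
      simp only [map_mul, map_pow, map_natCast, smul_eq_mul, nsmul_eq_mul,
        ← Polynomial.aeval_algHom_apply ι]
      ring

/-- **Transport of a derivation along an embedding** ("`D = (Dx)·d/dx` on algebraic functions of
`x`"): let `ι : A → B` be an injective `K`-algebra map of domains (`char K = 0`), `D`, `E`
`K`-derivations of `A`, `B`, `x ∈ A` transcendental over `K`, and `f ∈ A` a root of a non-zero
`m ∈ K[x][T]`. Then `ι(Df)·E(ιx) = ι(Dx)·E(ιf)`.
[cite: NesterenkoPhilippon2001, Ch. 10 §5, proof of Prop. 5.1 (p. 166, (83))] -/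
theorem derivation_transport_of_eval₂_eq_zero [CharZero K] [IsDomain B] (D : Derivation K A A)
    (E : Derivation K B B) (ι : A →ₐ[K] B) (hι : Function.Injective ι) {x f : A}
    (hx : Transcendental K x) {m : Polynomial (Polynomial K)} (hm0 : m ≠ 0)
    (hm : Polynomial.eval₂ (Polynomial.aeval x : Polynomial K →ₐ[K] A).toRingHom f m = 0) :
    ι (D f) * E (ι x) = ι (D x) * E (ι f) := by
  classical
  -- a non-zero annihilating polynomial of minimal `T`-degree
  have hexists : ∃ d, ∃ p : Polynomial (Polynomial K), p ≠ 0 ∧ p.natDegree = d ∧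
      Polynomial.eval₂ (Polynomial.aeval x : Polynomial K →ₐ[K] A).toRingHom f p = 0 :=
    ⟨m.natDegree, m, hm0, rfl, hm⟩
  obtain ⟨p, hp0, hpdeg, hp⟩ := Nat.find_spec hexists
  have hmin : ∀ q : Polynomial (Polynomial K), q ≠ 0 → q.natDegree < p.natDegree →
      Polynomial.eval₂ (Polynomial.aeval x : Polynomial K →ₐ[K] A).toRingHom f q ≠ 0 := by
    intro q hq0 hqdeg hq
    have := Nat.find_min hexists (hpdeg ▸ hqdeg)
    exact this ⟨q, hq0, rfl, hq⟩
  -- its `T`-degree is positive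
  have hpdeg0 : p.natDegree ≠ 0 := by
    intro h0
    rw [Polynomial.eq_C_of_natDegree_eq_zero h0, Polynomial.eval₂_C] at hp
    simp only [AlgHom.toRingHom_eq_coe, RingHom.coe_coe] at hp
    have hc : p.coeff 0 = 0 := (transcendental_iff_injective.mp hx) (by rw [hp, map_zero])
    apply hp0
    rw [Polynomial.eq_C_of_natDegree_eq_zero h0, hc, map_zero]
  -- so `p_T(x, f) ≠ 0`
  have hpT0 : derivative p ≠ 0 := fun h => hpdeg0 (Polynomial.derivative_eq_zero.mp h)
  have hpT : Polynomial.eval₂ (Polynomial.aeval x : Polynomial K →ₐ[K] A).toRingHom f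
      (derivative p) ≠ 0 :=
    hmin _ hpT0 (Polynomial.natDegree_derivative_lt hpdeg0)
  -- differentiate `p(x, f) = 0` in `A` and `p(ιx, ιf) = 0` in `B`
  obtain ⟨P, hD, hE⟩ := exists_derivation_eval₂ D E ι x f p
  rw [hp, map_zero] at hD
  rw [← algHom_eval₂_aeval, hp, map_zero, map_zero] at hE
  have hD' := congrArg ι hD
  rw [map_zero, map_add, map_mul, map_mul] at hD'
  -- eliminate `P`
  have key : ι (Polynomial.eval₂ (Polynomial.aeval x : Polynomial K →ₐ[K] A).toRingHom f
      (derivative p)) * (ι (D f) * E (ι x) - ι (D x) * E (ι f)) = 0 := by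
    linear_combination (-(E (ι x))) * hD' + (ι (D x)) * hE
  have hne : ι (Polynomial.eval₂ (Polynomial.aeval x : Polynomial K →ₐ[K] A).toRingHom f
      (derivative p)) ≠ 0 := fun h => hpT (hι (by rw [h, map_zero]))
  exact sub_eq_zero.mp ((mul_eq_zero.mp key).resolve_left hne)

/-! ### The transported identity is closed under the ring operations -/

/-- Sums. [folklore] -/
theorem derivation_transport_add (D : Derivation K A A) (E : Derivation K B B) (ι : A →ₐ[K] B)
    {x f g : A} (hf : ι (D f) * E (ι x) = ι (D x) * E (ι f))
    (hg : ι (D g) * E (ι x) = ι (D x) * E (ι g)) :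
    ι (D (f + g)) * E (ι x) = ι (D x) * E (ι (f + g)) := by
  rw [map_add, map_add, map_add, map_add]
  linear_combination hf + hg

/-- Products (Leibniz). [folklore] -/
theorem derivation_transport_mul (D : Derivation K A A) (E : Derivation K B B) (ι : A →ₐ[K] B)
    {x f g : A} (hf : ι (D f) * E (ι x) = ι (D x) * E (ι f))
    (hg : ι (D g) * E (ι x) = ι (D x) * E (ι g)) :
    ι (D (f * g)) * E (ι x) = ι (D x) * E (ι (f * g)) := by
  rw [Derivation.leibniz, map_mul, Derivation.leibniz, map_add, smul_eq_mul, smul_eq_mul,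
    smul_eq_mul, smul_eq_mul, map_mul, map_mul]
  linear_combination (ι f) * hg + (ι g) * hf

/-- Differences. [folklore] -/
theorem derivation_transport_sub (D : Derivation K A A) (E : Derivation K B B) (ι : A →ₐ[K] B)
    {x f g : A} (hf : ι (D f) * E (ι x) = ι (D x) * E (ι f))
    (hg : ι (D g) * E (ι x) = ι (D x) * E (ι g)) :
    ι (D (f - g)) * E (ι x) = ι (D x) * E (ι (f - g)) := by
  rw [map_sub, map_sub, map_sub, map_sub]
  linear_combination hf - hg

/-- Constants. [folklore] -/
theorem derivation_transport_algebraMap (D : Derivation K A A) (E : Derivation K B B)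
    (ι : A →ₐ[K] B) (x : A) (c : K) :
    ι (D (algebraMap K A c)) * E (ι x) = ι (D x) * E (ι (algebraMap K A c)) := by
  rw [Derivation.map_algebraMap, map_zero, zero_mul, AlgHom.commutes, Derivation.map_algebraMap,
    mul_zero]

/-- The element `x` itself. [folklore] -/
theorem derivation_transport_self (D : Derivation K A A) (E : Derivation K B B) (ι : A →ₐ[K] B)
    (x : A) : ι (D x) * E (ι x) = ι (D x) * E (ι x) := rfl

/-- Powers. [folklore] -/
theorem derivation_transport_pow (D : Derivation K A A) (E : Derivation K B B) (ι : A →ₐ[K] B)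
    {x f : A} (hf : ι (D f) * E (ι x) = ι (D x) * E (ι f)) (n : ℕ) :
    ι (D (f ^ n)) * E (ι x) = ι (D x) * E (ι (f ^ n)) := by
  induction n with
  | zero =>
    rw [pow_zero, ← map_one (algebraMap K A)]
    exact derivation_transport_algebraMap D E ι x 1
  | succ n ih =>
    rw [pow_succ]
    exact derivation_transport_mul D E ι ih hf

end Literature.Barriers.Schanuel

end
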